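import Summits.QuantumFields.YangMills.Theorems.ColdStartUniversalityLatticeLangevinGreenKuboLemma
import Summits.QuantumFields.YangMills.Theorems.ColdStartUniversalityLatticeLangevinStationarity
import Summits.QuantumFields.YangMills.Theorems.ColdStartUniversalityLatticeLangevinErgodicAverageEveryRealisation
import HarnessLib

/-!
# Route `ColdStartUniversality` (fixed-cut-off SZZ dynamics, sampler theory):
# ★★★ THE GREEN–KUBO / KIPNIS–VARADHAN ASYMPTOTIC VARIANCE OF TIME AVERAGES, FROM EVERY DETERMINISTIC START

Helper file (seat `ym-line-csu-p1`, g33, file 67).  For the SU(2) lattice Langevin dynamics of Shen–Zhu–Zhu on `(ℤ/L)³` at any coupling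
`β'` (`μ = μ_(β')` the Wilson measure, `κ` any realising Markov kernel family), every strong solution `U` from a deterministic start `x`
on ANY filtered probability space, every continuous observable `G` with `|G| ≤ 1` (`Ĝ = G − μ(G)`, stationary autocorrelation
`φ_Ĝ(t) = ∫ Ĝ·κ_tĜ dμ`) and every `T ≥ 0`:

  `| E[(∫_(0,T] Ĝ(U_r) dr)²] − 2T·∫_(0,∞) φ_Ĝ(t) dt | ≤ K`,   `K = K(L, β')`

(`abs_integral_sq_centered_sub_greenKubo_le`, jointly measurable realisation; `…_of_solution`, every strong solution), hence
`| E[(T⁻¹∫_(0,T] G(U_r) dr − μ(G))²] − σ²(G)/T | ≤ K/T²` with the GREEN–KUBO constant `σ²(G) = 2∫₀^∞ ⟨Ĝ, κ_tĜ⟩_μ dt`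
(`abs_integral_sq_timeAverage_sub_greenKubo_le_of_solution`): the mean-square ergodic theorem of file 49 (`≤ 4C/(cT)`) is sharpened to
its exact leading term.  Inputs: the Green–Kubo lemma (file 66), convergence to stationarity of the two-time laws
(`abs_twoTime_sub_stationary_le_exp`, file 53), time-like decorrelation (`abs_twoTime_centered_le_exp`, file 48), every-start mixing
(`exp_mixing_transitionKernel`) and joint continuity of the kernel action (`continuous_transitionKernel_action`).  Reading: with g16's
`integral_autocorrelation_eq_integral_mul_corrector` (`∫₀^∞ φ_Ĝ = ⟨Ĝ, u⟩_μ`, `u` the Poisson corrector) and g27's volume-uniform bound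
`∫₀^∞ φ_Ĝ ≤ ‖Ĝ‖²/(1 − 12|β'|)`, the MCMC error bar `σ²(G)/T` of the SZZ sampler is now identified at the process level.  THEOREMS ONLY, no sorry.
HONEST FRAMING: fixed cut-off; `K` depends on `L, β'` through the (existential) Doeblin constants; `UniformColdStartMixing` (24809) is NOT
restated; no crux, rung or summit statement is proved; the Yang–Mills mass gap is NOT proved.
-/

set_option autoImplicit false

noncomputable section

namespace Summit.QuantumFields.YangMills.Theorems.ColdStartUniversality

open MeasureTheory ProbabilityTheory Filter Topology Set
open scoped NNReal ENNReal BigOperators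
open Literature Literature.Probability.Process Literature.MathematicalPhysics.QuantumFieldTheory
open Literature.MathematicalPhysics.QuantumLattice (fundamentalRep fundamentalLatticeRep continuous_fundamentalRep)

variable {L : ℕ}

/-- ★★★ **Green–Kubo asymptotic variance along a jointly measurable strong solution.**  There is `K = K(L,β') ≥ 0` such that for every
realising kernel family `κ`, every jointly measurable strong solution `U` from a deterministic start, every continuous `G` with `|G| ≤ 1` and every
`T ≥ 0`: `|E[(∫_(0,T] (G(U_r) − μG) dr)²] − 2T ∫_(0,∞) ∫ Ĝ·κ_tĜ dμ dt| ≤ K`. [folklore] -/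
theorem abs_integral_sq_centered_sub_greenKubo_le (L : ℕ) [NeZero L] (β' : ℝ) :
    ∃ K : ℝ, 0 ≤ K ∧
      ∀ (κ : ℝ≥0 → Kernel (GaugeConfig 3 L (Matrix.specialUnitaryGroup (Fin 2) ℂ))
          (GaugeConfig 3 L (Matrix.specialUnitaryGroup (Fin 2) ℂ))) [∀ t, IsMarkovKernel (κ t)],
        (∀ (t : ℝ≥0) (x : GaugeConfig 3 L (Matrix.specialUnitaryGroup (Fin 2) ℂ))
          (Ω : Type) [MeasurableSpace Ω] (P : Measure Ω) [IsProbabilityMeasure P]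
          (W : ℝ≥0 → Ω → (Edge 3 L × NoiseIdx 2 → ℝ)) (hW : IsFlatBrownian W P)
          (U : ℝ≥0 → Ω → GaugeConfig 3 L (Matrix.specialUnitaryGroup (Fin 2) ℂ)),
          (∀ ω, U 0 ω = x) →
          (latticeLangevinDynamics (fundamentalLatticeRep 2) β').IsSolution (fundamentalRep (Fin 2))
            hW.natFiltration P W U →
          κ t x = P.map (U t)) →
        ∀ (x : GaugeConfig 3 L (Matrix.specialUnitaryGroup (Fin 2) ℂ))
          (Ω : Type) [MeasurableSpace Ω] (P : Measure Ω) [IsProbabilityMeasure P]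
          (W : ℝ≥0 → Ω → (Edge 3 L × NoiseIdx 2 → ℝ)) (hW : IsFlatBrownian W P)
          (U : ℝ≥0 → Ω → GaugeConfig 3 L (Matrix.specialUnitaryGroup (Fin 2) ℂ)),
          (∀ ω, U 0 ω = x) →
          (latticeLangevinDynamics (fundamentalLatticeRep 2) β').IsSolution (fundamentalRep (Fin 2)) hW.natFiltration P W U →
          Measurable (Function.uncurry U) →
        ∀ (G : GaugeConfig 3 L (Matrix.specialUnitaryGroup (Fin 2) ℂ) → ℝ), Continuous G → (∀ z, |G z| ≤ 1) →
        ∀ (T : ℝ), 0 ≤ T →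
          |(∫ ω, (∫ r in Ioc 0 T, (G (U r.toNNReal ω) - ∫ z, G z ∂(wilsonMeasure (d := 3) (L := L) (fundamentalRep (Fin 2)) β'))) ^ 2 ∂P) -
              2 * T * ∫ t in Ioi (0 : ℝ), (∫ y, (G y - ∫ z, G z ∂(wilsonMeasure (d := 3) (L := L) (fundamentalRep (Fin 2)) β')) *
                (∫ z, (G z - ∫ z', G z' ∂(wilsonMeasure (d := 3) (L := L) (fundamentalRep (Fin 2)) β')) ∂(κ t.toNNReal y))
                ∂(wilsonMeasure (d := 3) (L := L) (fundamentalRep (Fin 2)) β'))| ≤ K := by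
  classical
  haveI := secondCountableTopology_su2
  haveI := borelSpace_config L
  obtain ⟨C, c, hC, hc, h53⟩ := abs_twoTime_sub_stationary_le_exp L β'
  obtain ⟨C', c', hC', hc', h48⟩ := abs_twoTime_centered_le_exp L β'
  obtain ⟨C'', c'', hC'', hc'', hmix⟩ := exp_mixing_transitionKernel L β'
  set c₀ : ℝ := min c (min c' c'') with hc₀
  have hc₀pos : 0 < c₀ := lt_min hc (lt_min hc' hc'')
  have hc₀c : c₀ ≤ c := min_le_left _ _
  have hc₀c' : c₀ ≤ c' := (min_le_right _ _).trans (min_le_left _ _)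
  have hc₀c'' : c₀ ≤ c'' := (min_le_right _ _).trans (min_le_right _ _)
  have hrate : ∀ {a : ℝ} (t : ℝ), c₀ ≤ a → 0 ≤ t → Real.exp (-a * t) ≤ Real.exp (-c₀ * t) := fun t ha ht =>
    Real.exp_le_exp.2 (by nlinarith)
  set C₁ : ℝ := 4 * C with hC₁
  set C₂ : ℝ := 2 * C' + 4 * C'' with hC₂
  refine ⟨(32 * C₁ + 68 * C₂) / c₀ ^ 2, by positivity, fun κ _ hreal x Ω _ P _ W hW U hU0 hU hUj G hGc hG1 T hT => ?_⟩
  set μ : Measure (GaugeConfig 3 L (Matrix.specialUnitaryGroup (Fin 2) ℂ)) :=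
    wilsonMeasure (d := 3) (L := L) (fundamentalRep (Fin 2)) β' with hμ
  haveI : IsProbabilityMeasure μ :=
    isProbabilityMeasure_wilsonMeasure (d := 3) (L := L) (fundamentalRep (Fin 2)) (continuous_fundamentalRep (Fin 2)) β'
  have hG : Measurable G := hGc.measurable
  set m : ℝ := ∫ z, G z ∂μ with hm
  have hm1 : |m| ≤ 1 := by
    have hh := norm_integral_le_of_norm_le_const (μ := μ) (f := G) (C := 1)
      (Eventually.of_forall fun z => by simpa [Real.norm_eq_abs] using hG1 z)
    simpa [Real.norm_eq_abs] using hh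
  -- the centred observable `Ĝ = G − m` (`|Ĝ| ≤ 2`) and its half `G₂ = Ĝ/2` (`|G₂| ≤ 1`)
  set Gh : GaugeConfig 3 L (Matrix.specialUnitaryGroup (Fin 2) ℂ) → ℝ := fun z => G z - m with hGh
  have hGhc : Continuous Gh := hGc.sub continuous_const
  have hGhm : Measurable Gh := hGhc.measurable
  have hGhb : ∀ z, |Gh z| ≤ 2 := fun z => by
    show |G z - m| ≤ 2
    have := abs_sub (G z) m
    linarith [hG1 z]
  have hGh0 : ∫ z, Gh z ∂μ = 0 := by
    show ∫ z, (G z - m) ∂μ = 0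
    rw [integral_sub ((integrable_const (1 : ℝ)).mono' hG.aestronglyMeasurable
      (Eventually.of_forall fun z => by simpa [Real.norm_eq_abs] using hG1 z)) (integrable_const m), integral_const, smul_eq_mul,
      probReal_univ, one_mul, hm, sub_self]
  set G₂ : GaugeConfig 3 L (Matrix.specialUnitaryGroup (Fin 2) ℂ) → ℝ := fun z => Gh z / 2 with hG₂
  have hG₂m : Measurable G₂ := hGhm.div_const 2
  have hG₂b : ∀ z, |G₂ z| ≤ 1 := fun z => by
    show |Gh z / 2| ≤ 1
    rw [abs_div, abs_two]
    linarith [hGhb z]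
  -- the field `g r ω = Ĝ(U_r ω)` and the autocorrelation `φ`
  set g : ℝ → Ω → ℝ := fun r ω => Gh (U r.toNNReal ω) with hg
  have hgm : Measurable (Function.uncurry g) := by
    have h1 : Measurable fun q : ℝ × Ω => U q.1.toNNReal q.2 :=
      hUj.comp ((measurable_real_toNNReal.comp measurable_fst).prodMk measurable_snd)
    exact hGhm.comp h1
  have hgb : ∀ r ω, |g r ω| ≤ 2 := fun r ω => hGhb _
  set φ : ℝ → ℝ := fun t => ∫ y, Gh y * (∫ z, Gh z ∂(κ t.toNNReal y)) ∂μ with hφ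
  have hκm : ∀ t : ℝ≥0, Measurable fun y => ∫ z, Gh z ∂(κ t y) := fun t =>
    (hGhm.stronglyMeasurable.integral_kernel (κ := κ t)).measurable
  have hκb : ∀ (t : ℝ≥0) y, |∫ z, Gh z ∂(κ t y)| ≤ 2 * (C'' * Real.exp (-c'' * t)) := fun t y => by
    have h := hmix κ hreal y t Gh hGhm 2 hGhb
    rwa [hGh0, sub_zero] at h
  have hκb2 : ∀ (t : ℝ≥0) y, |∫ z, Gh z ∂(κ t y)| ≤ 2 := fun t y => by
    have hh := norm_integral_le_of_norm_le_const (μ := κ t y) (f := Gh) (C := 2)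
      (Eventually.of_forall fun z => by simpa [Real.norm_eq_abs] using hGhb z)
    simpa [Real.norm_eq_abs] using hh
  have hφc : Continuous φ := by
    refine continuous_of_dominated (bound := fun _ => (4 : ℝ)) (fun t => ((hGhm.mul (hκm _))).aestronglyMeasurable)
      (fun t => Eventually.of_forall fun y => ?_) (integrable_const _) (Eventually.of_forall fun y => ?_)
    · rw [norm_mul, Real.norm_eq_abs, Real.norm_eq_abs]
      calc |Gh y| * |∫ z, Gh z ∂(κ t.toNNReal y)| ≤ 2 * 2 :=
            mul_le_mul (hGhb y) (hκb2 _ y) (abs_nonneg _) zero_le_two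
        _ = 4 := by norm_num
    · exact continuous_const.mul ((continuous_transitionKernel_action β' κ hreal hGhc).comp
        (continuous_real_toNNReal.prodMk continuous_const))
  have hφb : ∀ u, 0 ≤ u → |φ u| ≤ C₂ * Real.exp (-c₀ * u) := by
    intro u hu
    have hu' : ((u.toNNReal : ℝ≥0) : ℝ) = u := Real.coe_toNNReal _ hu
    calc |φ u| ≤ ∫ y, |Gh y * (∫ z, Gh z ∂(κ u.toNNReal y))| ∂μ := abs_integral_le_integral_abs
      _ ≤ ∫ _y, 2 * (2 * (C'' * Real.exp (-c'' * u))) ∂μ := by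
          refine integral_mono_of_nonneg (Eventually.of_forall fun y => abs_nonneg _) (integrable_const _)
            (Eventually.of_forall fun y => ?_)
          dsimp only
          rw [abs_mul]
          have h := hκb u.toNNReal y
          rw [hu'] at h
          exact mul_le_mul (hGhb y) h (abs_nonneg _) zero_le_two
      _ = 4 * C'' * Real.exp (-c'' * u) := by rw [integral_const, smul_eq_mul, probReal_univ]; ring
      _ ≤ C₂ * Real.exp (-c₀ * u) := by
          have h1 : Real.exp (-c'' * u) ≤ Real.exp (-c₀ * u) := hrate u hc₀c'' hu
          have h2 : 4 * C'' ≤ C₂ := by rw [hC₂]; linarith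
          calc 4 * C'' * Real.exp (-c'' * u) ≤ 4 * C'' * Real.exp (-c₀ * u) := by gcongr
            _ ≤ C₂ * Real.exp (-c₀ * u) := by gcongr
  -- lattice times attached to `0 < r ≤ r'`
  have htimes : ∀ {r r' : ℝ}, 0 < r → r ≤ r' →
      r.toNNReal + (r' - r).toNNReal = r'.toNNReal ∧ ((r.toNNReal : ℝ≥0) : ℝ) = r ∧ (((r' - r).toNNReal : ℝ≥0) : ℝ) = r' - r := by
    intro r r' hr hle
    refine ⟨?_, Real.coe_toNNReal _ hr.le, Real.coe_toNNReal _ (sub_nonneg.2 hle)⟩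
    rw [← Real.toNNReal_add hr.le (sub_nonneg.2 hle), add_sub_cancel]
  -- (H1): convergence to stationarity at the earlier time
  have h1 : ∀ r ∈ Ioc 0 T, ∀ r' ∈ Ioc 0 T, r ≤ r' →
      |(∫ ω, g r ω * g r' ω ∂P) - φ (r' - r)| ≤ C₁ * Real.exp (-c₀ * r) := by
    intro r hr r' _ hle
    obtain ⟨hst, hsr, htr⟩ := htimes hr.1 hle
    have h := h53 κ hreal x Ω P W hW U hU0 hU r.toNNReal (r' - r).toNNReal G₂ G₂ hG₂m hG₂b hG₂m hG₂b
    rw [hst, hsr] at h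
    have hprod : (∫ ω, g r ω * g r' ω ∂P) = 4 * ∫ ω, G₂ (U r.toNNReal ω) * G₂ (U r'.toNNReal ω) ∂P := by
      rw [← integral_const_mul]
      refine integral_congr_ae (ae_of_all _ fun ω => ?_)
      simp only [hg, hG₂]
      ring
    have hφeq : φ (r' - r) = 4 * ∫ y, G₂ y * (∫ z, G₂ z ∂(κ (r' - r).toNNReal y)) ∂μ := by
      rw [← integral_const_mul]
      refine integral_congr_ae (ae_of_all _ fun y => ?_)
      simp only [hG₂]
      rw [integral_div]
      ring
    rw [hprod, hφeq, ← mul_sub, abs_mul, abs_of_pos (by norm_num : (0 : ℝ) < 4), hC₁]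
    calc 4 * |(∫ ω, G₂ (U r.toNNReal ω) * G₂ (U r'.toNNReal ω) ∂P) - ∫ y, G₂ y * (∫ z, G₂ z ∂(κ (r' - r).toNNReal y)) ∂μ|
        ≤ 4 * (C * Real.exp (-c * r)) := by gcongr
      _ ≤ 4 * (C * Real.exp (-c₀ * r)) :=
          mul_le_mul_of_nonneg_left (mul_le_mul_of_nonneg_left (hrate r hc₀c hr.1.le) hC.le) (by norm_num)
      _ = 4 * C * Real.exp (-c₀ * r) := by ring
  -- (H2): decorrelation
  have h2 : ∀ r ∈ Ioc 0 T, ∀ r' ∈ Ioc 0 T, r ≤ r' → |∫ ω, g r ω * g r' ω ∂P| ≤ C₂ * Real.exp (-c₀ * (r' - r)) := by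
    intro r hr r' _ hle
    obtain ⟨hst, -, htr⟩ := htimes hr.1 hle
    have h := h48 x Ω P W hW U hU0 hU r.toNNReal (r' - r).toNNReal G₂ G hG₂m hG₂b hG hG1
    rw [hst, htr] at h
    have hprod : (∫ ω, g r ω * g r' ω ∂P) = 2 * ∫ ω, G₂ (U r.toNNReal ω) * (G (U r'.toNNReal ω) - m) ∂P := by
      rw [← integral_const_mul]
      refine integral_congr_ae (ae_of_all _ fun ω => ?_)
      simp only [hg, hG₂, hGh]
      ring
    rw [hprod, abs_mul, abs_two]
    calc 2 * |∫ ω, G₂ (U r.toNNReal ω) * (G (U r'.toNNReal ω) - m) ∂P| ≤ 2 * (C' * Real.exp (-c' * (r' - r))) := by gcongr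
      _ ≤ 2 * (C' * Real.exp (-c₀ * (r' - r))) :=
          mul_le_mul_of_nonneg_left (mul_le_mul_of_nonneg_left (hrate (r' - r) hc₀c' (sub_nonneg.2 hle)) hC'.le) zero_le_two
      _ ≤ C₂ * Real.exp (-c₀ * (r' - r)) := by
          rw [hC₂]
          nlinarith [Real.exp_pos (-c₀ * (r' - r)), hC''.le]
  -- the Green–Kubo lemma
  have hmain := abs_integral_sq_setIntegral_sub_le_of_twoTime (P := P) hgm hgb hφc.measurable hT (by positivity) (by positivity)
    hc₀pos hφb h1 h2
  simpa only [hg, hφ, hGh] using hmain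

/-- ★★★ **Green–Kubo asymptotic variance along EVERY strong solution** (no joint-measurability hypothesis: pathwise uniqueness against the
jointly measurable flow of `exists_flow_measurable_uncurry`). [folklore] -/
theorem abs_integral_sq_centered_sub_greenKubo_le_of_solution (L : ℕ) [NeZero L] (β' : ℝ) :
    ∃ K : ℝ, 0 ≤ K ∧
      ∀ (κ : ℝ≥0 → Kernel (GaugeConfig 3 L (Matrix.specialUnitaryGroup (Fin 2) ℂ))
          (GaugeConfig 3 L (Matrix.specialUnitaryGroup (Fin 2) ℂ))) [∀ t, IsMarkovKernel (κ t)],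
        (∀ (t : ℝ≥0) (x : GaugeConfig 3 L (Matrix.specialUnitaryGroup (Fin 2) ℂ))
          (Ω : Type) [MeasurableSpace Ω] (P : Measure Ω) [IsProbabilityMeasure P]
          (W : ℝ≥0 → Ω → (Edge 3 L × NoiseIdx 2 → ℝ)) (hW : IsFlatBrownian W P)
          (U : ℝ≥0 → Ω → GaugeConfig 3 L (Matrix.specialUnitaryGroup (Fin 2) ℂ)),
          (∀ ω, U 0 ω = x) →
          (latticeLangevinDynamics (fundamentalLatticeRep 2) β').IsSolution (fundamentalRep (Fin 2))
            hW.natFiltration P W U →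
          κ t x = P.map (U t)) →
        ∀ (x : GaugeConfig 3 L (Matrix.specialUnitaryGroup (Fin 2) ℂ))
          (Ω : Type) [MeasurableSpace Ω] (P : Measure Ω) [IsProbabilityMeasure P]
          (W : ℝ≥0 → Ω → (Edge 3 L × NoiseIdx 2 → ℝ)) (hW : IsFlatBrownian W P)
          (U : ℝ≥0 → Ω → GaugeConfig 3 L (Matrix.specialUnitaryGroup (Fin 2) ℂ)),
          (∀ ω, U 0 ω = x) →
          (latticeLangevinDynamics (fundamentalLatticeRep 2) β').IsSolution (fundamentalRep (Fin 2)) hW.natFiltration P W U →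
        ∀ (G : GaugeConfig 3 L (Matrix.specialUnitaryGroup (Fin 2) ℂ) → ℝ), Continuous G → (∀ z, |G z| ≤ 1) →
        ∀ (T : ℝ), 0 ≤ T →
          |(∫ ω, (∫ r in Ioc 0 T, (G (U r.toNNReal ω) - ∫ z, G z ∂(wilsonMeasure (d := 3) (L := L) (fundamentalRep (Fin 2)) β'))) ^ 2 ∂P) -
              2 * T * ∫ t in Ioi (0 : ℝ), (∫ y, (G y - ∫ z, G z ∂(wilsonMeasure (d := 3) (L := L) (fundamentalRep (Fin 2)) β')) *
                (∫ z, (G z - ∫ z', G z' ∂(wilsonMeasure (d := 3) (L := L) (fundamentalRep (Fin 2)) β')) ∂(κ t.toNNReal y))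
                ∂(wilsonMeasure (d := 3) (L := L) (fundamentalRep (Fin 2)) β'))| ≤ K := by
  obtain ⟨K, hK, h⟩ := abs_integral_sq_centered_sub_greenKubo_le L β'
  refine ⟨K, hK, fun κ _ hreal x Ω _ P _ W hW U' hU'0 hU' G hGc hG1 T hT => ?_⟩
  obtain ⟨U, hU⟩ := LiebRobinson.exists_flow_measurable_uncurry L β' hW
  have hmain := h κ hreal x Ω P W hW (U x) (hU x).1 (hU x).2.1 (hU x).2.2 G hGc hG1 T hT
  have hae := latticeLangevin_pathwise_unique hW β' x hU'0 (hU x).1 hU' (hU x).2.1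
  have heq : (∫ ω, (∫ r in Ioc 0 T, (G (U' r.toNNReal ω) - ∫ z, G z ∂(wilsonMeasure (d := 3) (L := L) (fundamentalRep (Fin 2)) β'))) ^ 2 ∂P) =
      ∫ ω, (∫ r in Ioc 0 T, (G (U x r.toNNReal ω) - ∫ z, G z ∂(wilsonMeasure (d := 3) (L := L) (fundamentalRep (Fin 2)) β'))) ^ 2 ∂P := by
    refine integral_congr_ae ?_
    filter_upwards [hae] with ω hω
    have hfun : (fun r : ℝ => G (U' r.toNNReal ω) - ∫ z, G z ∂(wilsonMeasure (d := 3) (L := L) (fundamentalRep (Fin 2)) β')) =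
        fun r : ℝ => G (U x r.toNNReal ω) - ∫ z, G z ∂(wilsonMeasure (d := 3) (L := L) (fundamentalRep (Fin 2)) β') :=
      funext fun r => by rw [hω]
    simp only [hfun]
  rw [heq]
  exact hmain

/-- ★★★ **The mean-square error of the time average is `σ²(G)/T + O(T⁻²)`**: for every strong solution from a deterministic start,
every continuous `G` with `|G| ≤ 1` and every `T > 0`,
`|E[(T⁻¹∫_(0,T] G(U_r) dr − μ(G))²] − (2∫_(0,∞) ⟨Ĝ, κ_tĜ⟩_μ dt)/T| ≤ K/T²`. [folklore] -/
theorem abs_integral_sq_timeAverage_sub_greenKubo_le_of_solution (L : ℕ) [NeZero L] (β' : ℝ) :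
    ∃ K : ℝ, 0 ≤ K ∧
      ∀ (κ : ℝ≥0 → Kernel (GaugeConfig 3 L (Matrix.specialUnitaryGroup (Fin 2) ℂ))
          (GaugeConfig 3 L (Matrix.specialUnitaryGroup (Fin 2) ℂ))) [∀ t, IsMarkovKernel (κ t)],
        (∀ (t : ℝ≥0) (x : GaugeConfig 3 L (Matrix.specialUnitaryGroup (Fin 2) ℂ))
          (Ω : Type) [MeasurableSpace Ω] (P : Measure Ω) [IsProbabilityMeasure P]
          (W : ℝ≥0 → Ω → (Edge 3 L × NoiseIdx 2 → ℝ)) (hW : IsFlatBrownian W P)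
          (U : ℝ≥0 → Ω → GaugeConfig 3 L (Matrix.specialUnitaryGroup (Fin 2) ℂ)),
          (∀ ω, U 0 ω = x) →
          (latticeLangevinDynamics (fundamentalLatticeRep 2) β').IsSolution (fundamentalRep (Fin 2))
            hW.natFiltration P W U →
          κ t x = P.map (U t)) →
        ∀ (x : GaugeConfig 3 L (Matrix.specialUnitaryGroup (Fin 2) ℂ))
          (Ω : Type) [MeasurableSpace Ω] (P : Measure Ω) [IsProbabilityMeasure P]
          (W : ℝ≥0 → Ω → (Edge 3 L × NoiseIdx 2 → ℝ)) (hW : IsFlatBrownian W P)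
          (U : ℝ≥0 → Ω → GaugeConfig 3 L (Matrix.specialUnitaryGroup (Fin 2) ℂ)),
          (∀ ω, U 0 ω = x) →
          (latticeLangevinDynamics (fundamentalLatticeRep 2) β').IsSolution (fundamentalRep (Fin 2)) hW.natFiltration P W U →
        ∀ (G : GaugeConfig 3 L (Matrix.specialUnitaryGroup (Fin 2) ℂ) → ℝ), Continuous G → (∀ z, |G z| ≤ 1) →
        ∀ (T : ℝ), 0 < T →
          |(∫ ω, (T⁻¹ * (∫ r in Ioc 0 T, G (U r.toNNReal ω)) - ∫ z, G z ∂(wilsonMeasure (d := 3) (L := L) (fundamentalRep (Fin 2)) β')) ^ 2 ∂P) -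
              (2 * ∫ t in Ioi (0 : ℝ), (∫ y, (G y - ∫ z, G z ∂(wilsonMeasure (d := 3) (L := L) (fundamentalRep (Fin 2)) β')) *
                (∫ z, (G z - ∫ z', G z' ∂(wilsonMeasure (d := 3) (L := L) (fundamentalRep (Fin 2)) β')) ∂(κ t.toNNReal y))
                ∂(wilsonMeasure (d := 3) (L := L) (fundamentalRep (Fin 2)) β'))) / T| ≤ K / T ^ 2 := by
  obtain ⟨K, hK, h⟩ := abs_integral_sq_centered_sub_greenKubo_le_of_solution L β'
  refine ⟨K, hK, fun κ _ hreal x Ω _ P _ W hW U hU0 hU G hGc hG1 T hT => ?_⟩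
  have hmain := h κ hreal x Ω P W hW U hU0 hU G hGc hG1 T hT.le
  set m : ℝ := ∫ z, G z ∂(wilsonMeasure (d := 3) (L := L) (fundamentalRep (Fin 2)) β') with hm
  set σ : ℝ := ∫ t in Ioi (0 : ℝ), (∫ y, (G y - m) * (∫ z, (G z - m) ∂(κ t.toNNReal y))
    ∂(wilsonMeasure (d := 3) (L := L) (fundamentalRep (Fin 2)) β')) with hσ
  -- along almost every path the time integral of the centred observable is the centred time integral
  have hae : ∀ᵐ ω ∂P, (T⁻¹ * (∫ r in Ioc 0 T, G (U r.toNNReal ω)) - m) ^ 2 =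
      T⁻¹ ^ 2 * (∫ r in Ioc 0 T, (G (U r.toNNReal ω) - m)) ^ 2 := by
    filter_upwards [hU.continuous] with ω hω
    have hGi : IntegrableOn (fun r : ℝ => G (U r.toNNReal ω)) (Ioc 0 T) volume :=
      (hGc.comp (hω.comp continuous_real_toNNReal)).integrableOn_Ioc
    rw [integral_sub hGi (continuous_const.integrableOn_Ioc), setIntegral_const, smul_eq_mul,
      Real.volume_real_Ioc_of_le hT.le, sub_zero]
    field_simp
  rw [integral_congr_ae hae, integral_const_mul]
  have hT2 : (0 : ℝ) < T ^ 2 := by positivity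
  have hrew : T⁻¹ ^ 2 * (∫ ω, (∫ r in Ioc 0 T, (G (U r.toNNReal ω) - m)) ^ 2 ∂P) - 2 * σ / T =
      T⁻¹ ^ 2 * ((∫ ω, (∫ r in Ioc 0 T, (G (U r.toNNReal ω) - m)) ^ 2 ∂P) - 2 * T * σ) := by
    field_simp
  rw [hrew, abs_mul, abs_of_pos (by positivity : (0 : ℝ) < T⁻¹ ^ 2), inv_pow, ← div_eq_inv_mul]
  exact div_le_div_of_nonneg_right hmain hT2.le

end Summit.QuantumFields.YangMills.Theorems.ColdStartUniversality

end
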